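import Mathlib
import Literature.NumberTheory.Automorphic.HilbertModularFormQExpansion
import Summits.Langlands.Langlands.Theorems.CapacityClassicalityHilbertIntegralOverconvergentIsCongruenceFourierKoecher
import Summits.Langlands.Langlands.Theorems.CapacityClassicalityHilbertIntegralOverconvergentIsCongruenceStubModularFormPeriodic
import Summits.Langlands.Langlands.Theorems.CapacityClassicalityHilbertIntegralOverconvergentIsCongruenceHilbertClassicality

/-!
# Hilbert classicality modulo the named facts — the variant with a ℤ-INTEGRAL supply (line `Sketch-ideate-r1-k1`, § T,
# crux stmt-Langlands-8485)

Named fact (ii) of `hilbertClassicalityModuloNamedFacts` asks for forms with `𝓞_E`-integral `E`-rational Fourier coefficients whose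
`q`-series converge on the tube under EVERY complex embedding of `E` — for a GENERAL (non-parallel) weight the coefficients cannot be
rational and the conjugates are other forms.  In the main case of Hilbert modular forms with RATIONAL INTEGER Fourier coefficients
(available whenever `w₀` and `w₀ - k` are parallel — Eisenstein and theta series — and the natural supply for PARALLEL `k`) the
integrality and archimedean clauses are AUTOMATIC: the conjugates of an integer are the integer, and the `q`-series of a holomorphic
`𝓞 F`-periodic function converges absolutely on the whole tube (the landed Fourier expansion `hasSum_fourierCoeff`, Freitag I.4.1).
`hilbertClassicalityModuloNamedFacts_intSupply` is the end-to-end assembly with named fact (ii) in this ℤ-integral form: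
`d + 1` forms of weight `w₀` with linearly independent monomials and one form of weight `w₀ - k` non-zero on `ℍ`, all with INTEGER
Fourier coefficients on the cone — nothing else.
-/

set_option linter.dupNamespace false

noncomputable section

namespace Summit.Langlands.Langlands.Theorems.HilbertIntegralOverconvergentIsCongruence

open MeasureTheory Complex NumberField
open Literature.NumberTheory.Automorphic Literature.NumberTheory.Automorphic.HilbertModular
open scoped MatrixGroups NumberField

/-- **Integer Fourier coefficients give the `E`-rational data of named fact (ii) for free.**  For a Hilbert modular form `f` of level
`Γ₁(𝔫)` (`𝔫 ≠ 0`, `[F:ℚ] ≥ 2`) whose Fourier coefficients on the cone are the integers `q ν`, the function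
`qE ν := [ν ∈ cone] · (q ν : E)` is `𝓞_E`-integral, `τ`-rational for EVERY embedding `τ' : E → ℂ` (`τ' (qE ν) = q ν`), and its
`q`-series converges absolutely on the whole tube under every embedding (comparison with the Fourier expansion of `f`,
`hasSum_fourierCoeff`: on the cone the terms agree, off the cone `qE` vanishes). [folklore] -/
theorem hcm_intCoeff_data (F : Type) [Field F] [NumberField F] [NumberField.IsTotallyReal F]
    (𝔫 : Ideal (𝓞 F)) (E : Type) [Field E] [NumberField E] (b : (F →+* ℝ) → ℤ) (f : Point F → ℂ)
    (hf : f ∈ modularForms (Bianchi.Gamma1 𝔫) b) (q : F → ℤ) (hq : ∀ ν ∈ qIndexSet F, fourierCoeff f ν = (q ν : ℂ)) :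
    ∃ qE : F → E, (∀ (τ' : E →+* ℂ), ∀ ν ∈ qIndexSet F, fourierCoeff f ν = τ' (qE ν)) ∧ (∀ ν, IsIntegral ℤ (qE ν)) ∧
      ∀ (τ' : E →+* ℂ) (y : (F →+* ℝ) → ℝ), (∀ σ, 0 < y σ) →
        Summable (fun ν : {ν : F | ∀ a : 𝓞 F, ∃ n : ℤ, Algebra.trace ℚ F (ν * a) = n} ↦
          ‖τ' (qE ν)‖ * Real.exp (-(2 * Real.pi * ∑ σ : F →+* ℝ, σ (ν : F) * y σ))) := by
  classical
  refine ⟨fun ν ↦ if ν ∈ qIndexSet F then (q ν : E) else 0, fun τ' ν hν ↦ ?_, fun ν ↦ ?_, fun τ' y hy ↦ ?_⟩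
  · dsimp only
    rw [if_pos hν, map_intCast, hq ν hν]
  · dsimp only
    by_cases hν : ν ∈ qIndexSet F
    · rw [if_pos hν, ← eq_intCast (algebraMap ℤ E)]
      exact isIntegral_algebraMap
    · rw [if_neg hν]
      exact isIntegral_zero
  · -- comparison with the Fourier expansion of `f` at `z = iy`
    set z : Point F := fun σ ↦ ((y σ : ℝ) : ℂ) * I with hzdef
    have hz : z ∈ halfSpace F := fun σ ↦ by simpa [hzdef] using hy σ
    have hsum := (hasSum_fourierCoeff F f hf.holomorphic (stub_modularForm_periodic F 𝔫 b f hf) z hz).2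
    have him : ∀ σ, (z σ).im = y σ := fun σ ↦ by simp [hzdef]
    simp only [him] at hsum
    refine hsum.of_nonneg_of_le (fun ν ↦ mul_nonneg (norm_nonneg _) (Real.exp_pos _).le) (fun ν ↦ ?_)
    dsimp only
    refine mul_le_mul_of_nonneg_right ?_ (Real.exp_pos _).le
    by_cases hν : (ν : F) ∈ qIndexSet F
    · rw [if_pos hν, map_intCast, hq _ hν]
    · rw [if_neg hν, map_zero, norm_zero]
      exact norm_nonneg _

/-- **Hilbert classicality modulo the named facts, with a ℤ-INTEGRAL SUPPLY**: the end-to-end assembly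
`hilbertClassicalityModuloNamedFacts` with named fact (ii) in the form "`d + 1` Hilbert modular forms of weight `w₀` with linearly
independent monomials of every degree and one form of weight `w₀ - k` not vanishing on `ℍ`, all of level `Γ₁(𝔫)` with RATIONAL INTEGER
Fourier coefficients on the cone" (`hSupZ`; integrality, `E`-rationality and convergence of all conjugates on the tube are automatic,
`hcm_intCoeff_data`).  All other hypotheses and the conclusion are those of `hilbertClassicalityModuloNamedFacts`. [folklore] -/
theorem hilbertClassicalityModuloNamedFacts_intSupply (F : Type) [Field F] [NumberField F] [NumberField.IsTotallyReal F]
    (hd : 1 < Module.finrank ℚ F) (𝔫 : Ideal (𝓞 F)) (h𝔫 : 𝔫 ≠ ⊥)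
    (E : Type) [Field E] [NumberField E] (τ : E →+* ℂ) (p : ℕ) [Fact p.Prime] (v : E →+* PadicAlgCl p)
    (d : ℕ) (idx : F → (Fin d →₀ ℕ)) (α : F) (enc : (Point F → ℂ) → MvPowerSeries (Fin d) ℂ)
    (hd1 : 1 ≤ d) (hα : ∀ σ : F →+* ℝ, 0 < σ α) (hinj : Set.InjOn idx (qIndexSet F))
    (hadd : ∀ μ ∈ qIndexSet F, ∀ μ' ∈ qIndexSet F, idx (μ + μ') = idx μ + idx μ')
    (htrace : ∀ ν ∈ qIndexSet F, ((∑ j, idx ν j : ℕ) : ℚ) = Algebra.trace ℚ F (α * ν))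
    (henc : ∀ f : Point F → ℂ, (∀ μ ∈ qIndexSet F, MvPowerSeries.coeff (idx μ) (enc f) = fourierCoeff f μ) ∧
      ∀ n, (∀ μ ∈ qIndexSet F, idx μ ≠ n) → MvPowerSeries.coeff n (enc f) = 0)
    (hSt : ∃ (L : ((F →+* ℝ) → ℤ) → ℕ) (cS : ℝ), (∀ b, (L b : ℝ) ≤ cS * (∑ σ, |(b σ : ℝ)| + 1)) ∧
      ∀ (b : (F →+* ℝ) → ℤ) (f : Point F → ℂ), f ∈ modularForms (Bianchi.Gamma1 𝔫) b →
      ∀ q : F → E, (∀ ν ∈ qIndexSet F, fourierCoeff f ν = τ (q ν)) →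
      ∀ B : ℝ, 0 ≤ B →
        (∀ ν ∈ qIndexSet F, ((Algebra.trace ℚ F (α * ν) : ℚ) : ℝ) < L b → ‖v (q ν)‖ ≤ B) →
        ∀ ν ∈ qIndexSet F, ‖v (q ν)‖ ≤ B)
    (k : (F →+* ℝ) → ℤ)
    (hSupZ : ∃ (w₀ : (F →+* ℝ) → ℤ) (gf : Fin (d + 1) → Point F → ℂ) (qg : Fin (d + 1) → F → ℤ) (G : Point F → ℂ)
      (qG : F → ℤ),
      (∀ l, gf l ∈ modularForms (Bianchi.Gamma1 𝔫) w₀) ∧ G ∈ modularForms (Bianchi.Gamma1 𝔫) (w₀ - k) ∧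
      (∃ z ∈ halfSpace F, G z ≠ 0) ∧
      (∀ l, ∀ ν ∈ qIndexSet F, fourierCoeff (gf l) ν = (qg l ν : ℂ)) ∧ (∀ ν ∈ qIndexSet F, fourierCoeff G ν = (qG ν : ℂ)) ∧
      ∀ (m : ℕ) (κ : Sym (Fin (d + 1)) m → ℂ),
        (∀ z ∈ halfSpace F, ∑ s, κ s * ((s : Multiset (Fin (d + 1))).map (fun l ↦ gf l z)).prod = 0) → ∀ s, κ s = 0)
    (c : F → E) (hc_int : ∀ ν, IsIntegral ℤ (c ν)) (hc_supp : ∀ ν ∉ qIndexSet F, c ν = 0)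
    (harch_c : ∀ (τ' : E →+* ℂ) (y : (F →+* ℝ) → ℝ), (∀ σ, 0 < y σ) →
      Summable (fun ν : {ν : F | ∀ b : 𝓞 F, ∃ n : ℤ, Algebra.trace ℚ F (ν * b) = n} ↦
        ‖τ' (c ν)‖ * Real.exp (-(2 * Real.pi * ∑ σ : F →+* ℝ, σ (ν : F) * y σ))))
    (hKatz : ∃ (t : (F →+* ℝ) → ℤ) (e : MvPowerSeries (Fin d) (PadicAlgCl p)) (a : ℕ → MvPowerSeries (Fin d) (PadicAlgCl p))
      (ρ C : ℝ), t ≠ 0 ∧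
      e ∈ Submodule.span (PadicAlgCl p)
        {ψ | ∃ (A : MvPowerSeries (Fin d) E) (f : Point F → ℂ), f ∈ modularForms (Bianchi.Gamma1 𝔫) t ∧
          MvPowerSeries.map τ A = enc f ∧ ψ = MvPowerSeries.map v A} ∧
      MvPowerSeries.constantCoeff e = 1 ∧ (∀ n, ‖MvPowerSeries.coeff n e‖ ≤ 1) ∧
      (∀ i : ℕ, a i ∈ Submodule.span (PadicAlgCl p)
        {ψ | ∃ (A : MvPowerSeries (Fin d) E) (f : Point F → ℂ), f ∈ modularForms (Bianchi.Gamma1 𝔫) (k + i • t) ∧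
          MvPowerSeries.map τ A = enc f ∧ ψ = MvPowerSeries.map v A}) ∧
      0 < ρ ∧ ρ < 1 ∧ 0 ≤ C ∧ (∀ i n, ‖MvPowerSeries.coeff n (a i)‖ ≤ C * ρ ^ i) ∧
      (∀ ν ∈ qIndexSet F, HasSum (fun i : ℕ ↦ MvPowerSeries.coeff (idx ν) (a i * e⁻¹ ^ i)) (v (c ν))) ∧
      ∀ n, (∀ ν ∈ qIndexSet F, idx ν ≠ n) → HasSum (fun i : ℕ ↦ MvPowerSeries.coeff n (a i * e⁻¹ ^ i)) 0) :
    (∃ 𝔪 : Ideal (𝓞 F), 𝔪 ≠ ⊥ ∧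
      (halfSpace F).indicator (fun z ↦
        ∑' ν : {ν : F | ∀ b : 𝓞 F, ∃ n : ℤ, Algebra.trace ℚ F (ν * b) = n},
          τ (c ν) * cexp (2 * Real.pi * I * pairing (ν : F) z)) ∈ modularForms (Bianchi.Gamma1 𝔪) k) ∧
    ∀ ν : F, (∀ b : 𝓞 F, ∃ n : ℤ, Algebra.trace ℚ F (ν * b) = n) → ∀ y : (F →+* ℝ) → ℝ, (∀ σ, 0 < y σ) →
      fourierCoeffAt ((halfSpace F).indicator (fun z ↦
        ∑' ν : {ν : F | ∀ b : 𝓞 F, ∃ n : ℤ, Algebra.trace ℚ F (ν * b) = n},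
          τ (c ν) * cexp (2 * Real.pi * I * pairing (ν : F) z))) ν y = τ (c ν) := by
  obtain ⟨w₀, gf, qg, G, qG, hgf, hG, hG0, hqg, hqG, hindep⟩ := hSupZ
  choose qgE hqgE_rat hqgE_int hqgE_arch using fun l ↦ hcm_intCoeff_data F 𝔫 E w₀ (gf l) (hgf l) (qg l) (hqg l)
  obtain ⟨qGE, hqGE_rat, hqGE_int, hqGE_arch⟩ := hcm_intCoeff_data F 𝔫 E (w₀ - k) G hG qG hqG
  exact hilbertClassicalityModuloNamedFacts F hd 𝔫 h𝔫 E τ p v d idx α enc hd1 hα hinj hadd htrace henc hSt k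
    ⟨w₀, gf, qgE, G, qGE, hgf, hG, hG0, fun l ν hν ↦ hqgE_rat l τ ν hν, fun ν hν ↦ hqGE_rat τ ν hν, hqgE_int, hqGE_int,
      fun l τ' y hy ↦ hqgE_arch l τ' y hy, hqGE_arch, hindep⟩
    c hc_int hc_supp harch_c hKatz

end Summit.Langlands.Langlands.Theorems.HilbertIntegralOverconvergentIsCongruence

end
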